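import Summits.HubbardSuperconductivity.HubbardSuperconductivity.Theorems.DeformationLadderLadderThesisNormalForms
import Summits.HubbardSuperconductivity.HubbardSuperconductivity.Theorems.ChiralWindowCwThesisBlockGroundEnergy
import Literature.MathematicalPhysics.QuantumLattice.TraceInequalitiesProofs
import Literature.MathematicalPhysics.QuantumLattice.LiebFluxPhaseProofs
import Literature.MathematicalPhysics.QuantumLattice.DuhamelTwoPoint

/-!
# `LadderThesis` (stmt-HubbardSuperconductivity-1890) — the thermal lift (Golden–Thompson door)

Helpers for the crux `LadderThesis` of route `DeformationLadder`, formalising the first lemma and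
the composition of crux-idea `thermal-lift-golden-thompson` (crux-ideate r1 on this item):

* `re_partitionFn_add_le_re_trace_mul` — Golden–Thompson for Gibbs weights:
  `Re Z_β(A + W) ≤ Re tr(e^{-βA} e^{-βW})` for Hermitian `A, W` (the tree's discharged
  `goldenThompson_holds`).
* `thermalLift_groundEnergy_sub_ge` — **the thermal lift**: for Hermitian `A`, positive
  semidefinite `W` and `β > 0`, if `b ≤ -β⁻¹ log ⟨e^{-βW}⟩_{β,A}` (a Laplace-transform /
  large-deviation bound for `W` in the Gibbs state of the UNPERTURBED `A`) and
  `E₀(A) + β⁻¹ log Z_β(A) ≤ ε` (cold-entropy defect `E₀ - F_β ≤ ε`), then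
  `b - ε ≤ E₀(A + W) - E₀(A)`. Proof: `e^{-βE₀(A+W)} ≤ Z_β(A+W) ≤ tr(e^{-βA}e^{-βW}) = Z_β(A)·⟨e^{-βW}⟩`
  and the two hypotheses bound the two factors.
* `ladderThesis_of_thermalLift` — **composition to the crux by name**: if for some `U > 0`,
  `δ ∈ (0,1/2)`, `s > 0`, `b > 0`, inverse temperatures `β_L > 0` and all large even `L` the
  `(N_L, S^z = 0)`-sector compressions `A_L = H_L|_p`, `W_L = (s/L⁴)(Δ_dᴴΔ_d)|_p` of the pure Hubbard
  torus and of the pair penalty satisfy the cold-entropy bound `E₀(A_L) + β_L⁻¹ log Z_{β_L}(A_L) ≤ b/2`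
  and the condensate Laplace bound `b ≤ -β_L⁻¹ log ⟨e^{-β_L W_L}⟩_{β_L, A_L}`, then `LadderThesis`
  (thermal lift ⇒ uniform sector penalty gap `≥ b/2` via block ground energy = sector energy
  (`stub_blockGroundEnergy`) ⇒ `LadderThesis` by the landed normal form `ladderThesis_of_penaltyGap`).
  The two hypotheses are the typed stubs `ColdTorus` / `CondensateLD` of the idea, inlined (no new
  definition is introduced).
* `groundEnergy_sub_le_thermalFloor` — **the thermal floor** (necessity companion, Peierls–Bogoliubov):
  `E₀(A + W) - E₀(A) ≤ Re⟨W⟩_{β,A} + (E₀(A+W) + β⁻¹ log Z_β(A+W))`.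
* `thermalOrder_of_ladderThesis` — `LadderThesis` ⇒ at every `β > 0` the sector Gibbs state of the
  pure model has d-wave LRO density `≥ a - (cold-entropy defect of the penalised block)/s`: thermal
  order of the pure model wherever the penalised compressed model is cold.

Golden (1965), Thompson (1965) [Golden–Thompson]; Petz, Banach Center Publ. 30 (1994) 287, eq. (8);
Kato (1966) II-§5.4 for the one-sided slopes behind the normal form.
-/

noncomputable section

-- `dupNamespace`: the summit and the problem are both named `HubbardSuperconductivity` (layout D-0022)
set_option linter.dupNamespace false

namespace Summit.HubbardSuperconductivity.HubbardSuperconductivity.Theorems.DeformationLadder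

open Matrix Literature.MathematicalPhysics.QuantumLattice Literature.Probability.LatticeModels
open Summit.HubbardSuperconductivity.HubbardSuperconductivity.Theses.DeformationLadder
open scoped ComplexOrder

/-! ### The thermal lift for finite Hermitian matrices -/

section ThermalLift

variable {m : Type*} [Fintype m] [DecidableEq m]

/-- **Golden–Thompson for Gibbs weights**: `Re Z_β(A + W) ≤ Re tr(e^{-βA} e^{-βW})` for Hermitian
`A, W` and real `β` (the tree's `goldenThompson_holds` at `-βA`, `-βW`).
Petz, Banach Center Publ. 30 (1994) 287, eq. (8). [cite: Petz1994, eq. (8)] -/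
theorem re_partitionFn_add_le_re_trace_mul (β : ℝ) {A W : Matrix m m ℂ} (hA : A.IsHermitian)
    (hW : W.IsHermitian) :
    (partitionFn β (A + W)).re ≤ ((gibbsWeight β A * gibbsWeight β W).trace).re := by
  have h := goldenThompson_holds (𝕜 := ℂ) (n := m) (-(β : ℂ) • A) (-(β : ℂ) • W)
    (isHermitian_neg_smul β hA) (isHermitian_neg_smul β hW)
  rw [← smul_add] at h
  simpa only [partitionFn, gibbsWeight, RCLike.re_to_complex] using h

/-- `tr(e^{-βA} e^{-βW}) = Z_β(A) · ⟨e^{-βW}⟩_{β,A}` whenever `Z_β(A) ≠ 0`. [folklore] -/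
theorem trace_gibbsWeight_mul_eq (β : ℝ) (A W : Matrix m m ℂ) (hZ : partitionFn β A ≠ 0) :
    (gibbsWeight β A * gibbsWeight β W).trace =
      partitionFn β A * gibbsState β A (gibbsWeight β W) := by
  rw [gibbsState_apply, ← mul_assoc, mul_inv_cancel₀ hZ, one_mul]

/-- **The thermal lift** (first lemma of crux-idea `thermal-lift-golden-thompson` on
`stmt-HubbardSuperconductivity-1890`). For a Hermitian `A`, a positive semidefinite `W` and `β > 0`:
if `b ≤ -β⁻¹ log Re⟨e^{-βW}⟩_{β,A}` (Laplace bound for `W` in the Gibbs state of the UNPERTURBED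
`A`) and `E₀(A) + β⁻¹ log Re Z_β(A) ≤ ε` (cold-entropy defect `E₀(A) - F_β(A) ≤ ε`), then
`b - ε ≤ E₀(A + W) - E₀(A)`. Indeed `e^{-βE₀(A+W)} ≤ Z_β(A+W) ≤ tr(e^{-βA}e^{-βW}) = Z_β(A)·⟨e^{-βW}⟩`
(ground-state term of the partition function; Golden–Thompson), and the hypotheses say
`⟨e^{-βW}⟩ ≤ e^{-βb}`, `Z_β(A) ≤ e^{β(ε - E₀(A))}`. Petz (1994) eq. (8); Golden (1965);
Thompson (1965). [cite: Petz1994, eq. (8)] -/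
theorem thermalLift_groundEnergy_sub_ge [Nonempty m] {A W : Matrix m m ℂ} (hA : A.IsHermitian)
    (hW : W.PosSemidef) {β b ε : ℝ} (hβ : 0 < β)
    (hLD : b ≤ -(1 / β) * Real.log (gibbsState β A (gibbsWeight β W)).re)
    (hcold : A.groundEnergy + (1 / β) * Real.log (partitionFn β A).re ≤ ε) :
    b - ε ≤ (A + W).groundEnergy - A.groundEnergy := by
  have hWh : W.IsHermitian := hW.isHermitian
  have hAW : (A + W).IsHermitian := hA.add hWh
  -- `Z_β(A)` is real and positive
  have hZpos : 0 < partitionFn β A := partitionFn_pos β hA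
  have hZre : 0 < (partitionFn β A).re := (Complex.lt_def.1 hZpos).1
  have hZim : (partitionFn β A).im = 0 := by
    have := (Complex.lt_def.1 hZpos).2
    simpa using this.symm
  set Z : ℝ := (partitionFn β A).re with hZ
  set G : ℝ := (gibbsState β A (gibbsWeight β W)).re with hG
  -- `Re tr(e^{-βA} e^{-βW}) = Z · G`
  have htr : ((gibbsWeight β A * gibbsWeight β W).trace).re = Z * G := by
    rw [trace_gibbsWeight_mul_eq β A W hZpos.ne', Complex.mul_re, hZim, zero_mul, sub_zero]
  -- the chain `e^{-βE₀(A+W)} ≤ Z · G`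
  have h1 : Real.exp (-(β * (A + W).groundEnergy)) ≤ Z * G :=
    calc Real.exp (-(β * (A + W).groundEnergy)) ≤ (partitionFn β (A + W)).re :=
          exp_neg_mul_groundEnergy_le_partitionFn hAW β
      _ ≤ ((gibbsWeight β A * gibbsWeight β W).trace).re :=
          re_partitionFn_add_le_re_trace_mul β hA hWh
      _ = Z * G := htr
  have hGpos : 0 < G := by
    by_contra hle
    push Not at hle
    have : Z * G ≤ 0 := mul_nonpos_of_nonneg_of_nonpos hZre.le hle
    linarith [Real.exp_pos (-(β * (A + W).groundEnergy))]
  -- the two hypotheses as bounds on the two factors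
  have hG1 : G ≤ Real.exp (-(β * b)) := by
    have hlog : Real.log G ≤ -(β * b) := by
      have h := mul_le_mul_of_nonneg_left hLD hβ.le
      have e : β * (-(1 / β) * Real.log G) = -Real.log G := by field_simp
      rw [e] at h
      linarith
    calc G = Real.exp (Real.log G) := (Real.exp_log hGpos).symm
      _ ≤ Real.exp (-(β * b)) := Real.exp_le_exp.2 hlog
  have hZ1 : Z ≤ Real.exp (β * (ε - A.groundEnergy)) := by
    have hlog : Real.log Z ≤ β * (ε - A.groundEnergy) := by
      have h := mul_le_mul_of_nonneg_left hcold hβ.le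
      have e : β * (A.groundEnergy + 1 / β * Real.log Z) = β * A.groundEnergy + Real.log Z := by
        field_simp
      rw [e] at h
      linarith
    calc Z = Real.exp (Real.log Z) := (Real.exp_log hZre).symm
      _ ≤ Real.exp (β * (ε - A.groundEnergy)) := Real.exp_le_exp.2 hlog
  have h2 : Real.exp (-(β * (A + W).groundEnergy)) ≤
      Real.exp (β * (ε - A.groundEnergy) + -(β * b)) :=
    calc Real.exp (-(β * (A + W).groundEnergy)) ≤ Z * G := h1
      _ ≤ Real.exp (β * (ε - A.groundEnergy)) * Real.exp (-(β * b)) :=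
          mul_le_mul hZ1 hG1 hGpos.le (Real.exp_pos _).le
      _ = Real.exp (β * (ε - A.groundEnergy) + -(β * b)) := (Real.exp_add _ _).symm
  have h3 := Real.exp_le_exp.1 h2
  have h4 : β * (b - ε) ≤ β * ((A + W).groundEnergy - A.groundEnergy) := by linarith
  exact le_of_mul_le_mul_left h4 hβ

end ThermalLift

/-! ### Composition: the thermal door to `LadderThesis` -/

section Corner

-- the `(n,n)`-sector index type `{s : Finset (Orb Λ) // …}` needs a larger instance budget for
-- `DecidableEq` (structural instance through `Lex (Fin 2 → Fin L)`; tree precedent: CwThesisBlockGroundEnergy)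
set_option synthInstance.maxSize 512

/-- **`LadderThesis` through the thermal door** (composition target `ThermalPenaltyCorner` of
crux-idea `thermal-lift-golden-thompson`, hypotheses inlined). Suppose that for some `U > 0`,
`δ ∈ (0,1/2)`, `s > 0`, `b > 0`, a choice of inverse temperatures `β_L > 0` and all large even `L`,
the compressions `A_L = H_L|_p` and `W_L = ((s/L⁴)·Δ_dᴴΔ_d)|_p` of the pure Hubbard torus
`H_L = hubbardTorus 2 L 1 U` and of the d-wave pair penalty to the occupation sets `p` of the
`(N_L, S^z=0)` sector (`N_L = 2⌊(1-δ)L²/2⌋`; Lieb's `(n,n)` sector) satisfy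
(i) the cold-entropy bound `E₀(A_L) + β_L⁻¹ log Re Z_{β_L}(A_L) ≤ b/2` and
(ii) the condensate Laplace bound `b ≤ -β_L⁻¹ log Re⟨e^{-β_L W_L}⟩_{β_L, A_L}`.
Then `LadderThesis` holds: the thermal lift gives `E₀(A_L + W_L) - E₀(A_L) ≥ b/2`, block ground
energies are sector energies (`stub_blockGroundEnergy`), so the sector penalty gap of
`H_L + (s/L⁴)Δ_dᴴΔ_d` is `≥ b/2 = (b/(2s))·s` uniformly in `L`, and `ladderThesis_of_penaltyGap`
concludes. Golden (1965); Thompson (1965); Kato (1966) II-§5.4. [cite: Petz1994, eq. (8)] -/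
theorem ladderThesis_of_thermalLift
    (h : ∃ U : ℝ, 0 < U ∧ ∃ δ ∈ Set.Ioo (0:ℝ) (1 / 2), ∃ s : ℝ, 0 < s ∧ ∃ b : ℝ, 0 < b ∧
      ∃ β : ℕ → ℝ, ∃ L₀ : ℕ, ∀ (L : ℕ) [NeZero L], L₀ ≤ L → Even L →
        0 < β L ∧
        (((hubbardTorus 2 L 1 U).toBlock
              (fun σ => (upPart σ).card = ⌊(1 - δ) * (L : ℝ) ^ 2 / 2⌋₊ ∧
                (downPart σ).card = ⌊(1 - δ) * (L : ℝ) ^ 2 / 2⌋₊)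
              (fun σ => (upPart σ).card = ⌊(1 - δ) * (L : ℝ) ^ 2 / 2⌋₊ ∧
                (downPart σ).card = ⌊(1 - δ) * (L : ℝ) ^ 2 / 2⌋₊)).groundEnergy +
            (1 / β L) * Real.log (partitionFn (β L) ((hubbardTorus 2 L 1 U).toBlock
              (fun σ => (upPart σ).card = ⌊(1 - δ) * (L : ℝ) ^ 2 / 2⌋₊ ∧
                (downPart σ).card = ⌊(1 - δ) * (L : ℝ) ^ 2 / 2⌋₊)
              (fun σ => (upPart σ).card = ⌊(1 - δ) * (L : ℝ) ^ 2 / 2⌋₊ ∧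
                (downPart σ).card = ⌊(1 - δ) * (L : ℝ) ^ 2 / 2⌋₊))).re ≤ b / 2) ∧
        b ≤ -(1 / β L) * Real.log (gibbsState (β L)
            ((hubbardTorus 2 L 1 U).toBlock
              (fun σ => (upPart σ).card = ⌊(1 - δ) * (L : ℝ) ^ 2 / 2⌋₊ ∧
                (downPart σ).card = ⌊(1 - δ) * (L : ℝ) ^ 2 / 2⌋₊)
              (fun σ => (upPart σ).card = ⌊(1 - δ) * (L : ℝ) ^ 2 / 2⌋₊ ∧
                (downPart σ).card = ⌊(1 - δ) * (L : ℝ) ^ 2 / 2⌋₊))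
            (gibbsWeight (β L)
              ((((s / (L : ℝ) ^ 4 : ℝ) : ℂ) •
                ((pairField dWaveFormFactor L)ᴴ * pairField dWaveFormFactor L)).toBlock
              (fun σ => (upPart σ).card = ⌊(1 - δ) * (L : ℝ) ^ 2 / 2⌋₊ ∧
                (downPart σ).card = ⌊(1 - δ) * (L : ℝ) ^ 2 / 2⌋₊)
              (fun σ => (upPart σ).card = ⌊(1 - δ) * (L : ℝ) ^ 2 / 2⌋₊ ∧
                (downPart σ).card = ⌊(1 - δ) * (L : ℝ) ^ 2 / 2⌋₊)))).re) :
    LadderThesis := by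
  obtain ⟨U, hU, δ, hδ, s, hs, b, hb, β, L₀, hyp⟩ := h
  apply ladderThesis_of_penaltyGap
  refine ⟨U, hU, δ, hδ, s, hs, b / (2 * s), by positivity, L₀, fun L _ hL hE => ?_⟩
  obtain ⟨hβ, hcold, hLD⟩ := hyp L hL hE
  have has : b / (2 * s) * s = b / 2 := by field_simp
  rw [has]
  -- names
  set n : ℕ := ⌊(1 - δ) * (L : ℝ) ^ 2 / 2⌋₊ with hn
  set p : Finset (Orb (FermionTorus 2 L)) → Prop :=
    fun σ => (upPart σ).card = n ∧ (downPart σ).card = n with hp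
  set H := hubbardTorus 2 L 1 U with hH
  set P := ((s / (L : ℝ) ^ 4 : ℝ) : ℂ) •
    ((pairField dWaveFormFactor L)ᴴ * pairField dWaveFormFactor L) with hP
  -- `n ≤ L²`
  have hnL : n ≤ L ^ 2 := by
    have h1 : ((1 - δ) * (L : ℝ) ^ 2 / 2) ≤ (L : ℝ) ^ 2 := by
      have hδ0 := hδ.1
      have : 0 ≤ (L : ℝ) ^ 2 := by positivity
      nlinarith
    have h2 : (n : ℝ) ≤ (L : ℝ) ^ 2 := (Nat.floor_le (by nlinarith [hδ.1, hδ.2, sq_nonneg (L : ℝ)])).trans h1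
    exact_mod_cast h2
  -- hermiticity / positivity
  have hHh : H.IsHermitian := by
    have h := isHermitian_hubbardTorusWith L 1 U 0
    rwa [hubbardTorusWith_zero] at h
  have hPpsd : P.PosSemidef :=
    (pairField_conjTranspose_mul_self_posSemidef dWaveFormFactor L).smul (by positivity)
  have hHP : (H + P).IsHermitian := hHh.add hPpsd.isHermitian
  -- the block index type is nonempty (`pairSet α α` for an `n`-subset `α` of the `L²` sites)
  have hcard : Fintype.card (FermionTorus 2 L) = L ^ 2 :=
    Summit.HubbardSuperconductivity.NoGo.card_fermionTorus_two L
  obtain ⟨α, -, hα⟩ := Finset.exists_subset_card_eq (s := (Finset.univ : Finset (FermionTorus 2 L)))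
    (n := n) (by rw [Finset.card_univ, hcard]; exact hnL)
  haveI : Nonempty {σ : Finset (Orb (FermionTorus 2 L)) // p σ} :=
    ⟨⟨pairSet α α, by rw [upPart_pairSet, hα], by rw [downPart_pairSet, hα]⟩⟩
  -- blocks
  have hHb : (H.toBlock p p).IsHermitian := hHh.submatrix _
  have hPb : (P.toBlock p p).PosSemidef := hPpsd.submatrix _
  have hadd : (H + P).toBlock p p = H.toBlock p p + P.toBlock p p := rfl
  have e1 : (H.toBlock p p).groundEnergy = H.minEnergyOn (szSector (2 * n) 0) :=
    CwThesis.stub_blockGroundEnergy L H hHh hnL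
  have e2 : ((H + P).toBlock p p).groundEnergy = (H + P).minEnergyOn (szSector (2 * n) 0) :=
    CwThesis.stub_blockGroundEnergy L (H + P) hHP hnL
  -- the thermal lift on the blocks
  have key := thermalLift_groundEnergy_sub_ge hHb hPb hβ hLD hcold
  rw [← hadd, e1, e2] at key
  linarith

end Corner

/-! ### Necessity: the thermal floor (Peierls–Bogoliubov door) -/

section ThermalFloor

variable {m : Type*} [Fintype m] [DecidableEq m]

/-- **The thermal floor** (converse companion of `thermalLift_groundEnergy_sub_ge`). For Hermitian
`A, W` on a nonempty index type and `β > 0`: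
`E₀(A + W) - E₀(A) ≤ Re⟨W⟩_{β,A} + (E₀(A + W) + β⁻¹ log Re Z_β(A + W))`
— the shift of the ground energy is at most the thermal expectation of the perturbation in the
UNPERTURBED Gibbs state plus the cold-entropy defect `E₀ - F_β ≥ 0` of the PERTURBED matrix.
Proof: Peierls–Bogoliubov `Z_β(A+W) ≥ Z_β(A) e^{-β⟨W⟩_{β,A}}` (the tree's `Matrix.peierls_bogoliubov`)
and `Z_β(A) ≥ e^{-βE₀(A)}`. Bratteli–Robinson II §5.3.1; Tasaki (2020) App. A. [folklore] -/
theorem groundEnergy_sub_le_thermalFloor [Nonempty m] {A W : Matrix m m ℂ} (hA : A.IsHermitian)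
    (hW : W.IsHermitian) {β : ℝ} (hβ : 0 < β) :
    (A + W).groundEnergy - A.groundEnergy ≤
      (gibbsState β A W).re +
        ((A + W).groundEnergy + (1 / β) * Real.log (partitionFn β (A + W)).re) := by
  have hPB := Matrix.peierls_bogoliubov hA hW β
  have hZA := exp_neg_mul_groundEnergy_le_partitionFn hA β
  have hZApos : 0 < (partitionFn β A).re := lt_of_lt_of_le (Real.exp_pos _) hZA
  -- logarithms: `log Z(A) - β⟨W⟩ ≤ log Z(A+W)` and `-βE₀(A) ≤ log Z(A)`
  have h1 : Real.log (partitionFn β A).re + -(β * (gibbsState β A W).re) ≤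
      Real.log (partitionFn β (A + W)).re := by
    have := Real.log_le_log (mul_pos hZApos (Real.exp_pos _)) hPB
    rwa [Real.log_mul hZApos.ne' (Real.exp_pos _).ne', Real.log_exp] at this
  have h2 : -(β * A.groundEnergy) ≤ Real.log (partitionFn β A).re := by
    have := Real.log_le_log (Real.exp_pos _) hZA
    rwa [Real.log_exp] at this
  have h4 : β * (-A.groundEnergy) ≤
      β * ((gibbsState β A W).re + (1 / β) * Real.log (partitionFn β (A + W)).re) := by
    have e : β * ((gibbsState β A W).re + (1 / β) * Real.log (partitionFn β (A + W)).re) =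
        β * (gibbsState β A W).re + Real.log (partitionFn β (A + W)).re := by
      field_simp
    rw [e]
    linarith
  have h5 := le_of_mul_le_mul_left h4 hβ
  linarith

end ThermalFloor

section CornerNecessity

-- the `(n,n)`-sector index type needs a larger instance budget for `DecidableEq` (as above)
set_option synthInstance.maxSize 512

/-- **`LadderThesis` forces thermal d-wave order wherever the penalised model is cold** (necessity
through the thermal door). If `LadderThesis` holds then for some `U > 0`, `δ ∈ (0,1/2)`, `s > 0`,
`a > 0` and all large even `L`, for EVERY inverse temperature `β > 0`, the Gibbs state of the
sector compression `A_L = H_L|_p` of the pure Hubbard torus has d-wave LRO density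
`L⁻⁴ Re⟨(Δ_dᴴΔ_d)|_p⟩_{β, A_L} ≥ a - (1/s)·(E₀(A_L + W_L) + β⁻¹ log Re Z_β(A_L + W_L))`,
`W_L = ((s/L⁴)Δ_dᴴΔ_d)|_p`: thermal order of the PURE model at every temperature at which the
cold-entropy defect of the PENALISED compressed model is small compared with `a·s`. Proof: normal form
II (`penaltyGap_of_ladderThesis`: sector penalty gap `≥ a·s`), block = sector energies
(`stub_blockGroundEnergy`), and the thermal floor. [cite: KaplanHorschVonDerLinden1989] -/
theorem thermalOrder_of_ladderThesis (h : LadderThesis) :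
    ∃ U : ℝ, 0 < U ∧ ∃ δ ∈ Set.Ioo (0:ℝ) (1 / 2), ∃ s : ℝ, 0 < s ∧ ∃ a : ℝ, 0 < a ∧ ∃ L₀ : ℕ,
      ∀ (L : ℕ) [NeZero L], L₀ ≤ L → Even L → ∀ β : ℝ, 0 < β →
        a ≤ (gibbsState β
              ((hubbardTorus 2 L 1 U).toBlock
                (fun σ => (upPart σ).card = ⌊(1 - δ) * (L : ℝ) ^ 2 / 2⌋₊ ∧
                  (downPart σ).card = ⌊(1 - δ) * (L : ℝ) ^ 2 / 2⌋₊)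
                (fun σ => (upPart σ).card = ⌊(1 - δ) * (L : ℝ) ^ 2 / 2⌋₊ ∧
                  (downPart σ).card = ⌊(1 - δ) * (L : ℝ) ^ 2 / 2⌋₊))
              (((pairField dWaveFormFactor L)ᴴ * pairField dWaveFormFactor L).toBlock
                (fun σ => (upPart σ).card = ⌊(1 - δ) * (L : ℝ) ^ 2 / 2⌋₊ ∧
                  (downPart σ).card = ⌊(1 - δ) * (L : ℝ) ^ 2 / 2⌋₊)
                (fun σ => (upPart σ).card = ⌊(1 - δ) * (L : ℝ) ^ 2 / 2⌋₊ ∧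
                  (downPart σ).card = ⌊(1 - δ) * (L : ℝ) ^ 2 / 2⌋₊))).re / (L : ℝ) ^ 4 +
          (1 / s) *
            (((hubbardTorus 2 L 1 U +
                  ((s / (L : ℝ) ^ 4 : ℝ) : ℂ) •
                    ((pairField dWaveFormFactor L)ᴴ * pairField dWaveFormFactor L)).toBlock
                (fun σ => (upPart σ).card = ⌊(1 - δ) * (L : ℝ) ^ 2 / 2⌋₊ ∧
                  (downPart σ).card = ⌊(1 - δ) * (L : ℝ) ^ 2 / 2⌋₊)
                (fun σ => (upPart σ).card = ⌊(1 - δ) * (L : ℝ) ^ 2 / 2⌋₊ ∧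
                  (downPart σ).card = ⌊(1 - δ) * (L : ℝ) ^ 2 / 2⌋₊)).groundEnergy +
              (1 / β) * Real.log (partitionFn β
                ((hubbardTorus 2 L 1 U +
                  ((s / (L : ℝ) ^ 4 : ℝ) : ℂ) •
                    ((pairField dWaveFormFactor L)ᴴ * pairField dWaveFormFactor L)).toBlock
                (fun σ => (upPart σ).card = ⌊(1 - δ) * (L : ℝ) ^ 2 / 2⌋₊ ∧
                  (downPart σ).card = ⌊(1 - δ) * (L : ℝ) ^ 2 / 2⌋₊)
                (fun σ => (upPart σ).card = ⌊(1 - δ) * (L : ℝ) ^ 2 / 2⌋₊ ∧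
                  (downPart σ).card = ⌊(1 - δ) * (L : ℝ) ^ 2 / 2⌋₊))).re) := by
  obtain ⟨U, hU, δ, hδ, s, hs, a, ha, L₀, hgap⟩ := penaltyGap_of_ladderThesis h
  refine ⟨U, hU, δ, hδ, s, hs, a, ha, L₀, fun L _ hL hE β hβ => ?_⟩
  have hg := hgap L hL hE
  -- names
  set n : ℕ := ⌊(1 - δ) * (L : ℝ) ^ 2 / 2⌋₊ with hn
  set p : Finset (Orb (FermionTorus 2 L)) → Prop :=
    fun σ => (upPart σ).card = n ∧ (downPart σ).card = n with hp
  set H := hubbardTorus 2 L 1 U with hH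
  set Pm := (pairField dWaveFormFactor L)ᴴ * pairField dWaveFormFactor L with hPm
  set P := ((s / (L : ℝ) ^ 4 : ℝ) : ℂ) • Pm with hP
  have hL0 : (0 : ℝ) < L := Nat.cast_pos.2 (Nat.pos_of_ne_zero (NeZero.ne L))
  have hL4 : (0 : ℝ) < (L : ℝ) ^ 4 := by positivity
  -- `n ≤ L²`
  have hnL : n ≤ L ^ 2 := by
    have h1 : ((1 - δ) * (L : ℝ) ^ 2 / 2) ≤ (L : ℝ) ^ 2 := by
      have : 0 ≤ (L : ℝ) ^ 2 := by positivity
      nlinarith [hδ.1, hδ.2]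
    have h2 : (n : ℝ) ≤ (L : ℝ) ^ 2 :=
      (Nat.floor_le (by nlinarith [hδ.1, hδ.2, sq_nonneg (L : ℝ)])).trans h1
    exact_mod_cast h2
  -- hermiticity
  have hHh : H.IsHermitian := by
    have h := isHermitian_hubbardTorusWith L 1 U 0
    rwa [hubbardTorusWith_zero] at h
  have hPpsd : P.PosSemidef :=
    (pairField_conjTranspose_mul_self_posSemidef dWaveFormFactor L).smul (by positivity)
  have hHP : (H + P).IsHermitian := hHh.add hPpsd.isHermitian
  -- nonempty block index
  have hcard : Fintype.card (FermionTorus 2 L) = L ^ 2 :=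
    Summit.HubbardSuperconductivity.NoGo.card_fermionTorus_two L
  obtain ⟨α, -, hα⟩ := Finset.exists_subset_card_eq (s := (Finset.univ : Finset (FermionTorus 2 L)))
    (n := n) (by rw [Finset.card_univ, hcard]; exact hnL)
  haveI : Nonempty {σ : Finset (Orb (FermionTorus 2 L)) // p σ} :=
    ⟨⟨pairSet α α, by rw [upPart_pairSet, hα], by rw [downPart_pairSet, hα]⟩⟩
  -- blocks
  have hHb : (H.toBlock p p).IsHermitian := hHh.submatrix _
  have hPb : (P.toBlock p p).IsHermitian := hPpsd.isHermitian.submatrix _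
  have hadd : (H + P).toBlock p p = H.toBlock p p + P.toBlock p p := rfl
  have hsmul : P.toBlock p p = ((s / (L : ℝ) ^ 4 : ℝ) : ℂ) • Pm.toBlock p p := rfl
  have e1 : (H.toBlock p p).groundEnergy = H.minEnergyOn (szSector (2 * n) 0) :=
    CwThesis.stub_blockGroundEnergy L H hHh hnL
  have e2 : ((H + P).toBlock p p).groundEnergy = (H + P).minEnergyOn (szSector (2 * n) 0) :=
    CwThesis.stub_blockGroundEnergy L (H + P) hHP hnL
  -- the thermal floor on the blocks
  have key := groundEnergy_sub_le_thermalFloor hHb hPb hβ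
  rw [← hadd, e1, e2, hsmul, LinearMap.map_smul_of_tower, smul_eq_mul, Complex.re_ofReal_mul] at key
  -- `a s ≤ gap ≤ (s/L⁴)·G + defect`; divide by `s`
  have h1 : a * s ≤ s / (L : ℝ) ^ 4 * (gibbsState β (H.toBlock p p) (Pm.toBlock p p)).re +
      ((H + P).minEnergyOn (szSector (2 * n) 0) +
        1 / β * Real.log (partitionFn β ((H + P).toBlock p p)).re) := by
    linarith
  have h2 : a = (a * s) * (1 / s) := by field_simp
  have h3 : (s / (L : ℝ) ^ 4 * (gibbsState β (H.toBlock p p) (Pm.toBlock p p)).re +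
      ((H + P).minEnergyOn (szSector (2 * n) 0) +
        1 / β * Real.log (partitionFn β ((H + P).toBlock p p)).re)) * (1 / s) =
      (gibbsState β (H.toBlock p p) (Pm.toBlock p p)).re / (L : ℝ) ^ 4 +
        1 / s * ((H + P).minEnergyOn (szSector (2 * n) 0) +
          1 / β * Real.log (partitionFn β ((H + P).toBlock p p)).re) := by
    field_simp
  rw [e2, h2, ← h3]
  exact mul_le_mul_of_nonneg_right h1 (by positivity)

end CornerNecessity

end Summit.HubbardSuperconductivity.HubbardSuperconductivity.Theorems.DeformationLadder

end
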